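import Summits.QuantumFields.YangMills.Theses.UnitScaleTilt
import Literature.MathematicalPhysics.QuantumFieldTheory.Balaban1983to89.T3RestrictedUnitDensity

/-!
# Route `UnitScaleTilt` — crux K2 `HistoryTail` (stmt-QuantumFields-18916): DENSITY TRANSFER for the per-plaquette schema — the Gibbs
# mass of a large block-averaged plaquette at height `j` IS the Haar integral of the `j`-fold renormalised density over the large-plaquette
# event, over `Z_K` (support file; sub-lemma S1 of the split card)

Fleet lead `ym-ust-18916-p1` (gen 0); split card `CARD-18916-K2-split.md` (evidence #12 on the item), sub-lemma **S1** (size S, tree glue).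
Mechanism A of the owner's K2 memo bounds the per-plaquette large-field Gibbs tail at height `j` through the level-`j` EFFECTIVE density
`ρ_j = T^jρ₀` of [Balaban1985UV3] (2) p.256 for the route's averaging `ℰp` (tree: `T3RestrictedUnitDensity.resDensity F γ K univ j`, the
un-normalised push-forward density along the `j`-fold (0.4) block averaging), to which the representation (41)/(47) applies.  THIS FILE is the
exact identity that starts that chain: **`gibbsK_real_largePlaquette_eq`** —
`Gibbs_K{U : θ ≤ |Ū^{j}(∂p) − 1|} = (∫ ρ_j(W)·1{θ ≤ |W(∂p) − 1|} dW) / Z_K` for every cutoff `K`, height `j ≤ m + K`, plaquette `p` of `T^{(j)}`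
and threshold `θ` (from `integral_resDensity_mul` with `S = univ` and `T4GenFunBounds.integral_gibbsMeasure`), together with the general form
for a measurable event of the height-`j` field (`gibbsK_real_preimage_iter_eq`).

WHAT THIS IS NOT: no estimate; nothing of (41)/(47); nothing uses (α).
-/

noncomputable section

open MeasureTheory
open Literature.MathematicalPhysics.QuantumFieldTheory.Balaban1983to89
open Literature.MathematicalPhysics.QuantumFieldTheory.Balaban1983to89.T3ContinuumYM3Torus
open Literature.MathematicalPhysics.QuantumFieldTheory.Balaban1983to89.T3UnitScaleTilt
open Literature.MathematicalPhysics.QuantumFieldTheory.Balaban1983to89.T3UnitLawDensityEML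
open Literature.MathematicalPhysics.QuantumFieldTheory.Balaban1983to89.T3RestrictedUnitDensity
open Literature.MathematicalPhysics.QuantumFieldTheory.Balaban1983to89.Missing (boltzmann partitionFn measurable_plaqHol)
open Literature.MathematicalPhysics.QuantumFieldTheory.Balaban1983to89.T4Continuum (measurable_iter)

namespace Summit.QuantumFields.YangMills.Theorems.HistoryTailDensityTransfer

variable (F : T3Family) {γ : ℝ}

/-- **GIBBS MASS OF A HEIGHT-`j` EVENT = HAAR INTEGRAL OF THE `j`-FOLD RENORMALISED DENSITY OVER IT, OVER `Z_K`**: for a measurable event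
`E` of the height-`j` field (`j ≤ m + K`), `Gibbs_K{U : Ū^{j} ∈ E} = (∫ ρ_j·1_E dW)/Z_K` with `ρ_j = resDensity F γ K univ j` (Bałaban's
`T^jρ₀` of (2) for the averaging `ℰp`, un-normalised). [cite: Balaban1985UV3, (2) p.256 and (6) p.257] -/
theorem gibbsK_real_preimage_iter_eq (hγ : 0 ≤ γ) {K j : ℕ} (hj : j ≤ F.m + K)
    {E : Set (GaugeField (F.P K) j (Matrix.specialUnitaryGroup (Fin 2) ℂ))} (hE : MeasurableSet E) :
    (gibbsK F ℰp γ K).real ((fun U => Averaging.iter (fun _ => BlockAveraging.blockAvg ℰp) j U) ⁻¹' E) =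
      (∫ W, resDensity F γ K Set.univ j W * E.indicator 1 W ∂fieldMeasure (F.P K) j (Matrix.specialUnitaryGroup (Fin 2) ℂ)) /
        partitionFn (G := Matrix.specialUnitaryGroup (Fin 2) ℂ) (F.P K) ((F.scheme ℰp γ).β K) := by
  have hβ := F.scheme_β_nonneg ℰp hγ K
  -- the event of fine fields is the preimage of `E` under the (measurable) `j`-fold averaging
  have hiter : Measurable (fun U : GaugeField (F.P K) 0 (Matrix.specialUnitaryGroup (Fin 2) ℂ) =>
      Averaging.iter (fun _ => BlockAveraging.blockAvg ℰp) j U) :=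
    measurable_iter _ (F.avgMeasurable_of_measurableE ℰp measurableE_ℰp K) j
  have hpre : MeasurableSet ((fun U : GaugeField (F.P K) 0 (Matrix.specialUnitaryGroup (Fin 2) ℂ) =>
      Averaging.iter (fun _ => BlockAveraging.blockAvg ℰp) j U) ⁻¹' E) := hiter hE
  -- left-hand side as an integral of an indicator, then through the Gibbs density
  rw [← integral_indicator_one hpre, gibbsK_eq, T4GenFunBounds.integral_gibbsMeasure (F.P K) hβ]
  congr 1
  -- right-hand side through `integral_resDensity_mul` with `S = univ`
  have hf : Measurable (E.indicator (1 : GaugeField (F.P K) j (Matrix.specialUnitaryGroup (Fin 2) ℂ) → ℝ)) :=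
    measurable_const.indicator hE
  have hC : ∃ C : ℝ, ∀ V, |E.indicator (1 : GaugeField (F.P K) j (Matrix.specialUnitaryGroup (Fin 2) ℂ) → ℝ) V| ≤ C := by
    refine ⟨1, fun V => ?_⟩
    by_cases hV : V ∈ E
    · simp [Set.indicator_of_mem hV]
    · simp [Set.indicator_of_notMem hV]
  rw [integral_resDensity_mul F K MeasurableSet.univ hγ hj _ hf hC]
  refine integral_congr_ae (ae_of_all _ fun U => ?_)
  classical
  simp only [Set.indicator_apply, Set.mem_univ, if_true, Set.mem_preimage, Pi.one_apply]
  split_ifs <;> ring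

/-- **DENSITY TRANSFER FOR THE PER-PLAQUETTE SCHEMA** (sub-lemma S1): for every cutoff `K`, height `j ≤ m + K`, plaquette `p` of `T^{(j)}` and
threshold `θ`, `Gibbs_K{U : θ ≤ |Ū^{j}(∂p) − 1|} = (∫ ρ_j(W)·1{θ ≤ |W(∂p) − 1|} dW)/Z_K`, `ρ_j = resDensity F γ K univ j`.
[cite: Balaban1985UV3, (2) p.256 and (6) p.257] -/
theorem gibbsK_real_largePlaquette_eq (hγ : 0 ≤ γ) {K j : ℕ} (hj : j ≤ F.m + K) (p : Plaq (F.P K) j) (θ : ℝ) :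
    (gibbsK F ℰp γ K).real
        {U | θ ≤ GaugeGroup.dist1 (GaugeField.plaqHol (Averaging.iter (fun _ => BlockAveraging.blockAvg ℰp) j U) p)} =
      (∫ W, resDensity F γ K Set.univ j W *
            {W : GaugeField (F.P K) j (Matrix.specialUnitaryGroup (Fin 2) ℂ) |
                θ ≤ GaugeGroup.dist1 (GaugeField.plaqHol W p)}.indicator 1 W
          ∂fieldMeasure (F.P K) j (Matrix.specialUnitaryGroup (Fin 2) ℂ)) /
        partitionFn (G := Matrix.specialUnitaryGroup (Fin 2) ℂ) (F.P K) ((F.scheme ℰp γ).β K) := by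
  have hE : MeasurableSet {W : GaugeField (F.P K) j (Matrix.specialUnitaryGroup (Fin 2) ℂ) |
      θ ≤ GaugeGroup.dist1 (GaugeField.plaqHol W p)} :=
    measurableSet_le measurable_const (RegularGaugeGroup.measurable_dist1.comp (measurable_plaqHol p))
  have hset : {U : GaugeField (F.P K) 0 (Matrix.specialUnitaryGroup (Fin 2) ℂ) |
        θ ≤ GaugeGroup.dist1 (GaugeField.plaqHol (Averaging.iter (fun _ => BlockAveraging.blockAvg ℰp) j U) p)} =
      (fun U => Averaging.iter (fun _ => BlockAveraging.blockAvg ℰp) j U) ⁻¹'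
        {W : GaugeField (F.P K) j (Matrix.specialUnitaryGroup (Fin 2) ℂ) | θ ≤ GaugeGroup.dist1 (GaugeField.plaqHol W p)} := rfl
  rw [hset]
  exact gibbsK_real_preimage_iter_eq F hγ hj hE

/-- The same at the heights `j ≤ K` of the schema (`K ≤ m + K`). [cite: Balaban1985UV3, (2) p.256] -/
theorem gibbsK_real_largePlaquette_eq' (hγ : 0 ≤ γ) {K j : ℕ} (hjK : j ≤ K) (p : Plaq (F.P K) j) (θ : ℝ) :
    (gibbsK F ℰp γ K).real
        {U | θ ≤ GaugeGroup.dist1 (GaugeField.plaqHol (Averaging.iter (fun _ => BlockAveraging.blockAvg ℰp) j U) p)} =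
      (∫ W, resDensity F γ K Set.univ j W *
            {W : GaugeField (F.P K) j (Matrix.specialUnitaryGroup (Fin 2) ℂ) |
                θ ≤ GaugeGroup.dist1 (GaugeField.plaqHol W p)}.indicator 1 W
          ∂fieldMeasure (F.P K) j (Matrix.specialUnitaryGroup (Fin 2) ℂ)) /
        partitionFn (G := Matrix.specialUnitaryGroup (Fin 2) ℂ) (F.P K) ((F.scheme ℰp γ).β K) :=
  gibbsK_real_largePlaquette_eq F hγ (hjK.trans (Nat.le_add_left K F.m)) p θ

end Summit.QuantumFields.YangMills.Theorems.HistoryTailDensityTransfer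

end
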